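import Summits.QuantumFields.YangMills.Theses.GronwallGap
import Literature.Analysis.Matrix.SchoenbergKernelsProofs
import Literature.RepresentationTheory.CompactGroups.UnitaryTrick

/-!
# Crux `AnalyticDetour` (stmt-QuantumFields-8801), line `registered`:
# the stub `stub_wilsonSegmentAdm` (the Wilson segment is an admissible weight path)

Registered stub of the skeleton `Cruxes/AnalyticDetour/Lines/registered.lean` (route
`GronwallGap`, sub-problem `YangMills`), proved verbatim.  For a faithful continuous unitary
lattice representation `r : LatticeRep G` of a compact group and `βa, βb ≥ 0`, the straight
WILSON SEGMENT of single-plaquette weights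
`w s g = exp(((1 - s) βa + s βb) · Re tr r.ρ g)`, `s ∈ [0, 1]`,
is ADMISSIBLE in the sense of the crux (the predicate `Adm` of the statement):

* each `w s` is continuous (`Continuous.matrix_trace`) and positive (`Real.exp_pos`);
* a class function (the character is one: `trace_conj_eq`);
* symmetric under inversion, `w s g⁻¹ = w s g`: `r.ρ g⁻¹ = (r.ρ g)ᴴ` for a unitary-valued
  homomorphism, and `Re tr Mᴴ = Re tr M`;
* of positive type as a function on `G` with COMPLEX coefficients: the kernel
  `(x, y) ↦ Re tr r.ρ(x⁻¹ y) = Re tr (r.ρ x)ᴴ (r.ρ y) = ∑_{a b} (Re ρx_{ba} Re ρy_{ba} + Im ρx_{ba} Im ρy_{ba})`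
  is a finite sum of Gram kernels `f(x) f(y)`, hence positive definite
  (`Literature.Analysis.Matrix.isPosDefKernel_mul_fun`, `.add`, `isPosDefKernel_finsetSum`,
  Berg–Christensen–Ressel Ch. 3 §1.9–1.11); so is `exp(c · kernel)` for `c ≥ 0`
  (`IsPosDefKernel.const_mul`, `IsPosDefKernel.exp`, BCR Cor. 3.1.14); and a real positive
  definite kernel is of positive type for complex coefficients because
  `Re ∑ conj(cᵢ) cⱼ K(xᵢ,xⱼ) = Q(Re c) + Q(Im c)` with `Q` the real quadratic form;
* `s ↦ log w s = ((1 - s) βa + s βb) Re tr r.ρ` is Lipschitz in sup norm with constant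
  `|βb - βa| · N` (`|Re tr r.ρ g| ≤ N`, `abs_re_trace_le_card`).

The hypothesis of the stub (entrywise exponential preserves positive semidefiniteness, the
neighbouring stub `stub_expPosSemidef`) is offered by the skeleton but not needed on this kernel
route; it is introduced and ignored.

No named facts are used; no definitions are introduced (the helper lemmas are private).
-/

namespace Summit.QuantumFields.YangMills.Theorems

open Literature.Analysis.Matrix Literature.MathematicalPhysics.QuantumFieldTheory

section Helpers

variable {G : Type} [Group G] [TopologicalSpace G]

/-- For a unitary-valued homomorphism, `ρ(g⁻¹) = ρ(g)ᴴ`: both are left inverses of `ρ g`. -/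
private theorem latticeRep_map_inv (r : LatticeRep G) (g : G) : r.ρ g⁻¹ = star (r.ρ g) := by
  have h1 : r.ρ g⁻¹ * r.ρ g = 1 := by rw [← map_mul, inv_mul_cancel, map_one]
  calc r.ρ g⁻¹ = r.ρ g⁻¹ * (r.ρ g * star (r.ρ g)) := by
        rw [Matrix.mem_unitaryGroup_iff.1 (r.mem_unitary g), Matrix.mul_one]
    _ = star (r.ρ g) := by rw [← Matrix.mul_assoc, h1, Matrix.one_mul]

/-- Symmetry of the character under inversion, `Re tr ρ(g⁻¹) = Re tr ρ(g)` (unitarity). -/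
private theorem latticeRep_re_trace_map_inv (r : LatticeRep G) (g : G) :
    (r.ρ g⁻¹).trace.re = (r.ρ g).trace.re := by
  rw [latticeRep_map_inv, Matrix.star_eq_conjTranspose, Matrix.trace_conjTranspose,
    Complex.star_def, Complex.conj_re]

/-- **Gram expansion of the character kernel**:
`Re tr ρ(x⁻¹ y) = ∑_{a b} (Re ρ(x)_{ba} Re ρ(y)_{ba} + Im ρ(x)_{ba} Im ρ(y)_{ba})`. -/
private theorem latticeRep_re_trace_inv_mul (r : LatticeRep G) (x y : G) :
    (r.ρ (x⁻¹ * y)).trace.re =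
      ∑ a, ∑ b, ((r.ρ x b a).re * (r.ρ y b a).re + (r.ρ x b a).im * (r.ρ y b a).im) := by
  rw [map_mul, latticeRep_map_inv, Matrix.star_eq_conjTranspose, Matrix.trace]
  simp only [Matrix.diag_apply, Matrix.mul_apply, Matrix.conjTranspose_apply, Complex.star_def,
    Complex.re_sum, Complex.mul_re, Complex.conj_re, Complex.conj_im]
  exact Finset.sum_congr rfl fun a _ => Finset.sum_congr rfl fun b _ => by ring

/-- **The character kernel `(x, y) ↦ Re tr ρ(x⁻¹ y)` of a unitary representation is positive
definite** (a finite sum of Gram kernels `f(x) f(y)`, BCR Ch. 3 §1.9 and §1.11). -/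
private theorem latticeRep_isPosDefKernel (r : LatticeRep G) :
    IsPosDefKernel fun x y : G => (r.ρ (x⁻¹ * y)).trace.re := by
  have e : (fun x y : G => (r.ρ (x⁻¹ * y)).trace.re) = fun x y =>
      ∑ a, ∑ b, ((r.ρ x b a).re * (r.ρ y b a).re + (r.ρ x b a).im * (r.ρ y b a).im) := by
    funext x y
    exact latticeRep_re_trace_inv_mul r x y
  rw [e]
  exact isPosDefKernel_finsetSum _ fun a _ => isPosDefKernel_finsetSum _ fun b _ =>
    (isPosDefKernel_mul_fun fun x => (r.ρ x b a).re).add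
      (isPosDefKernel_mul_fun fun x => (r.ρ x b a).im)

/-- **A real positive definite kernel is of positive type for complex coefficients**:
`Re ∑ᵢⱼ conj(cᵢ) cⱼ K(xᵢ, xⱼ) = Q(Re c) + Q(Im c) ≥ 0`, `Q(d) = ∑ᵢⱼ dᵢ dⱼ K(xᵢ, xⱼ)`. -/
private theorem re_sum_conj_mul_nonneg {X : Type*} {K : X → X → ℝ} (hK : IsPosDefKernel K)
    {n : ℕ} (x : Fin n → X) (c : Fin n → ℂ) :
    0 ≤ (∑ i, ∑ j, (starRingEnd ℂ) (c i) * c j * ((K (x i) (x j) : ℝ) : ℂ)).re := by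
  have e : (∑ i, ∑ j, (starRingEnd ℂ) (c i) * c j * ((K (x i) (x j) : ℝ) : ℂ)).re =
      ∑ i, ∑ j, (c i).re * (c j).re * K (x i) (x j) +
        ∑ i, ∑ j, (c i).im * (c j).im * K (x i) (x j) := by
    rw [← Finset.sum_add_distrib, Complex.re_sum]
    refine Finset.sum_congr rfl fun i _ => ?_
    rw [← Finset.sum_add_distrib, Complex.re_sum]
    refine Finset.sum_congr rfl fun j _ => ?_
    simp only [Complex.mul_re, Complex.ofReal_re, Complex.ofReal_im, Complex.conj_re,
      Complex.conj_im]
    ring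
  rw [e]
  exact add_nonneg (hK.2 n x fun i => (c i).re) (hK.2 n x fun i => (c i).im)

end Helpers

/-- **Stub `stub_wilsonSegmentAdm` — the Wilson segment is admissible.**  For `βa, βb ≥ 0` the
path `s ↦ (g ↦ exp(((1-s)βa + sβb) Re tr r.ρ g))` satisfies `Adm`: continuity, positivity, class
function, symmetry under inversion (unitarity), positive type (the Gram kernel
`Re tr ρ(x)ᴴ ρ(y)` exponentiated, BCR Cor. 3.1.14, then real-to-complex coefficients), and
log-Lipschitz constant `|βb - βa| · N`.  The offered hypothesis (entrywise exponential preserves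
positive semidefiniteness) is not needed on this route. -/
theorem stub_wilsonSegmentAdm :
    (∀ (n : ℕ) (A : Matrix (Fin n) (Fin n) ℝ), A.PosSemidef → (A.map Real.exp).PosSemidef) → ∀ (G : Type) [Group G] [TopologicalSpace G] [IsTopologicalGroup G] [CompactSpace G], Literature.MathematicalPhysics.QuantumFieldTheory.IsCompactSimpleLieGroup G → letI : MeasurableSpace G := borel G; haveI : BorelSpace G := ⟨rfl⟩; let Adm : (ℝ → G → ℝ) → Prop := fun w => (∀ s ∈ Set.Icc (0 : ℝ) 1, Continuous (w s) ∧ (∀ g : G, 0 < w s g) ∧ (∀ g h : G, w s (h * g * h⁻¹) = w s g) ∧ (∀ g : G, w s g⁻¹ = w s g) ∧ (∀ (n : ℕ) (x : Fin n → G) (c : Fin n → ℂ), 0 ≤ (∑ i, ∑ j, (starRingEnd ℂ) (c i) * c j * ((w s ((x i)⁻¹ * x j) : ℝ) : ℂ)).re)) ∧ ∃ Λ : ℝ, ∀ s ∈ Set.Icc (0 : ℝ) 1, ∀ s' ∈ Set.Icc (0 : ℝ) 1, ∀ g : G, |Real.log (w s g) - Real.log (w s' g)| ≤ Λ * |s -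 s'|; ∀ (r : Literature.MathematicalPhysics.QuantumFieldTheory.LatticeRep G) (βa βb : ℝ), 0 ≤ βa → 0 ≤ βb → Adm (fun s g => Real.exp (((1 - s) * βa + s * βb) * (r.ρ g).trace.re)) := by
  intro _hexp G _ _ _ _ _hG Adm r βa βb hβa hβb
  simp only [Adm]
  refine ⟨fun s hs => ⟨?_, fun g => Real.exp_pos _, fun g h => ?_, fun g => ?_, fun n x c => ?_⟩,
    |βb - βa| * r.N, fun s _ s' _ g => ?_⟩
  · -- continuity
    exact Real.continuous_exp.comp
      (continuous_const.mul (Complex.continuous_re.comp r.continuous.matrix_trace))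
  · -- class function
    rw [Literature.RepresentationTheory.CompactGroups.CompactGroup.trace_conj_eq]
  · -- symmetry under inversion
    rw [latticeRep_re_trace_map_inv]
  · -- positive type: exponential of a nonnegative multiple of the Gram kernel
    have hc : 0 ≤ (1 - s) * βa + s * βb := by
      obtain ⟨hs0, hs1⟩ := hs
      nlinarith
    exact re_sum_conj_mul_nonneg ((latticeRep_isPosDefKernel r).const_mul hc).exp x c
  · -- log-Lipschitz in `s`, uniformly in `g`
    rw [Real.log_exp, Real.log_exp]
    have hN : |(r.ρ g).trace.re| ≤ r.N := by
      simpa using Literature.RepresentationTheory.CompactGroups.CompactGroup.abs_re_trace_le_card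
        r.ρ r.continuous g
    have e : ((1 - s) * βa + s * βb) * (r.ρ g).trace.re - ((1 - s') * βa + s' * βb) *
        (r.ρ g).trace.re = (βb - βa) * (s - s') * (r.ρ g).trace.re := by ring
    rw [e, abs_mul, abs_mul]
    calc |βb - βa| * |s - s'| * |(r.ρ g).trace.re| ≤ |βb - βa| * |s - s'| * r.N :=
          mul_le_mul_of_nonneg_left hN (by positivity)
      _ = |βb - βa| * r.N * |s - s'| := by ring

end Summit.QuantumFields.YangMills.Theorems
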